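import Summits.MatrixMultiplication.MatrixMultiplication.Theorems.AbelianSTPPCensusTAStatBDefs
import Summits.MatrixMultiplication.MatrixMultiplication.Theorems.AbelianSTPPCensusTAStatLemmas

/-!
# T_A certificate, second range `5001 … 5666`: data facts and structural soundness (part 1; verbatim the first range at universe `5666`)

Cell mm-stpp (rung F-M1), threshold T_A = `τ = 2.371`; checker in `AbelianSTPPCensusTAStatBDefs.lean` (design: `AbelianSTPPCensusTAStatDefs.lean`).  VERBATIM
`AbelianSTPPCensusTAStatRows.lean` in the namespace `TAStatB` at the universe `5666` (data `TAStatBData`; statements spell `TAStatB.`/`TAStatBData.` explicitly because the gate's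
landed-statement key is textual; the data-free lemmas `TAStat.getD_drop_add`,
`TAStat.pcs_sound`, `TAStat.tm_sorted` are reused by name; `exists_sorted` is restated for this universe's `SCand`).  Proofs only:
* facts about the concrete data by evaluation (`levOf_spec`, `levOf_step`, `bucketOf_spec`, `bucketOf_step`, `tb_step`, `tb_two`, `tb_sq`,
  `row_length`, `sentinel`) and their monotone consequences (`levOf_mono`, `bucketOf_mono`, `tb_mono`);
* the candidate enumeration is complete for sorted candidates (`mem_triplesS`);
* unpacking of the Boolean certificates: `domV_sound` / `domWrow_sound` (domination of every sorted candidate shape at its own level and at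
  every bucket from its own on), `mono_P` / `mono_W` (transfer along levels and buckets from `monoOK`), `dominated` (the packaged domination at
  `(levOf V_l, bucketOf t*)`), `checkV_sound`, `walk_sound`, `pcs_sound`.
Continued in `AbelianSTPPCensusTAStatSound.lean` (the arithmetic: Grynkiewicz budget at `t′ ≤ t*`, affine / quadratic interval lemmas,
`sum_gain_le`, `not_beats_of_cert`).
WHAT THIS IS NOT: arithmetic about the checker only; no statement about STPP families or `ω`.
-/

set_option linter.dupNamespace false
set_option autoImplicit false

namespace Summit.MatrixMultiplication.MatrixMultiplication.Theorems.TAStatB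

open TECert (tableOK vol us tableOK_iff)
open ShapeCert (gainOf2371h D)
open TAStatBData (E VL TB nl nb)
open TAStat (tm Entry e0 domP leP leW vpI p1I p2I p3I piece pcs vpCand vpThresh cover tm_sorted getD_drop_add pcs_sound)

/-! ## Facts about the concrete data (by evaluation) -/

/-- every volume `V ≤ Mtop` has a level, and the level covers it -/
theorem levOf_spec : ∀ V ≤ 5666, levOf V < nl ∧ V ≤ VL.getD (levOf V) 0 := by decide +kernel

/-- `levOf` is monotone, one step -/
theorem levOf_step : ∀ V < 5666, levOf V ≤ levOf (V + 1) := by decide +kernel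

/-- `levOf` is monotone on `[0, Mtop]` -/
theorem levOf_mono {V V' : ℕ} (h : V ≤ V') (h' : V' ≤ 5666) : levOf V ≤ levOf V' := by
  induction V', h using Nat.le_induction with
  | base => exact le_rfl
  | succ n hn ih => exact (ih (by omega)).trans (levOf_step n (by omega))

/-- every parameter `1 ≤ t ≤ 331` has a bucket `j < nb` with `TB[j] ≤ t < TB[j+1]` -/
theorem bucketOf_spec : ∀ t ≤ 331, 1 ≤ t → bucketOf t < nb ∧ tb (bucketOf t) ≤ t ∧ t < tb (bucketOf t + 1) := by decide +kernel

/-- `bucketOf` is monotone, one step -/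
theorem bucketOf_step : ∀ t ≤ 330, bucketOf t ≤ bucketOf (t + 1) := by decide +kernel

/-- `bucketOf` is monotone on `[0, 331]` -/
theorem bucketOf_mono {t t' : ℕ} (h : t ≤ t') (h' : t' ≤ 331) : bucketOf t ≤ bucketOf t' := by
  induction t', h using Nat.le_induction with
  | base => exact le_rfl
  | succ n hn ih => exact (ih (by omega)).trans (bucketOf_step n (by omega))

/-- the bucket lower ends increase -/
theorem tb_step : ∀ j < TAStatBData.nb, TAStatB.tb j < TAStatB.tb (j + 1) := by decide +kernel

/-- … at most double -/
theorem tb_two : ∀ j < TAStatBData.nb, TAStatB.tb (j + 1) ≤ 2 * TAStatB.tb j := by decide +kernel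

/-- … and at most square, from `3` on -/
theorem tb_sq : ∀ j < TAStatBData.nb, 3 ≤ TAStatB.tb j → TAStatB.tb (j + 1) ≤ TAStatB.tb j * TAStatB.tb j := by decide +kernel

/-- the bucket lower ends are monotone -/
theorem tb_mono {j j' : ℕ} (h : j ≤ j') (h' : j' ≤ TAStatBData.nb) : TAStatB.tb j ≤ TAStatB.tb j' := by
  induction j', h using Nat.le_induction with
  | base => exact le_rfl
  | succ n hn ih => exact (ih (by omega)).trans (tb_step n (by omega)).le

/-- every row of the table has `nb` entries -/
theorem row_length : ∀ i < TAStatBData.nl, (TAStatBData.E.getD i []).length = TAStatBData.nb := by decide +kernel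

/-- the sentinel: `t³ ≤ Mtop²` forces `t ≤ 317 < TB[nb] = 332` -/
theorem sentinel {t : ℕ} (h : t ^ 3 ≤ 5666 ^ 2) : t ≤ 317 := by
  by_contra hc
  have h1 : 318 ^ 3 ≤ t ^ 3 := Nat.pow_le_pow_left (by omega) 3
  have h2 : (5666 : ℕ) ^ 2 < 318 ^ 3 := by norm_num
  omega

/-- numerals -/
theorem nb_eq : nb = 99 := rfl
/-- numerals -/
theorem nl_eq : nl = 90 := rfl
/-- numerals -/
theorem tb_nb : tb nb = 332 := by decide

/-! ## The candidate enumeration is complete for sorted candidates -/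

/-- A sorted candidate shape is listed under its volume. [bookkeeping] -/
theorem mem_triplesS {a b c : ℕ} (h : TAStatB.SCand (a, b, c)) : (a, b, c) ∈ TAStatB.triplesS (a * b * c) := by
  obtain ⟨ha, hab, hbc, ht⟩ := h
  simp only at ha hab hbc ht
  have hV : a * b * c ≤ 5666 := by
    have := (tableOK_iff _ _ _ _).1 ht
    exact this.1
  have hb : 1 ≤ b := le_trans ha hab
  have hc : 1 ≤ c := le_trans hb hbc
  -- bounds on a and b
  have ha17 : a ≤ 17 := by
    by_contra hlt
    have h1 : 18 * 18 * 18 ≤ a * b * c :=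
      Nat.mul_le_mul (Nat.mul_le_mul (by omega) (by omega)) (by omega)
    omega
  have hb75 : b ≤ 75 := by
    by_contra hlt
    have h1 : 1 * 76 * 76 ≤ a * b * c := Nat.mul_le_mul (Nat.mul_le_mul ha (by omega)) (by omega)
    omega
  have hVa : a * b * c / a = b * c := by rw [mul_assoc]; exact Nat.mul_div_cancel_left _ (by omega)
  have hVab : b * c / b = c := Nat.mul_div_cancel_left _ (by omega)
  simp only [triplesS, List.mem_flatMap, List.mem_range]
  refine ⟨a - 1, by omega, ?_⟩
  rw [Nat.sub_add_cancel ha, if_pos (by rw [mul_assoc]; exact Nat.mul_mod_right _ _), List.mem_filterMap]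
  refine ⟨b - 1, by rw [List.mem_range]; omega, ?_⟩
  rw [Nat.sub_add_cancel hb, hVa, hVab]
  rw [if_pos ⟨by omega, Nat.mul_mod_right _ _, hbc, ht⟩]

/-! ## Sorted forms (this universe's `SCand`) -/

/-- Every shape with sizes `≥ 1` passing the table at `Mtop` has a sorted candidate form `y` with the same volume, pair-product sum and size sum,
whose first two entries are the smallest size and the smaller of the other two, in one of the three letter positions. [bookkeeping] -/
theorem exists_sorted (a b c : ℕ) (ha : 1 ≤ a) (hb : 1 ≤ b) (hc : 1 ≤ c) (ht : tableOK TAStatB.Mtop a b c = true) :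
    ∃ y : ℕ × ℕ × ℕ, TAStatB.SCand y ∧ vol y = a * b * c ∧ us y = a * b + b * c + c * a ∧ y.1 + y.2.1 + y.2.2 = a + b + c ∧
      ((y.1 = a ∧ y.2.1 = min c b ∧ a ≤ c ∧ a ≤ b) ∨ (y.1 = b ∧ y.2.1 = min a c ∧ b ≤ a ∧ b ≤ c) ∨
        (y.1 = c ∧ y.2.1 = min b a ∧ c ≤ b ∧ c ≤ a)) := by
  rcases le_total a b with hab | hab <;> rcases le_total b c with hbc | hbc <;> rcases le_total a c with hac | hac
  · exact ⟨(a, b, c), ⟨ha, hab, hbc, ht⟩, rfl, rfl, rfl, Or.inl ⟨rfl, by show b = min c b; rw [min_eq_right hbc], hac, hab⟩⟩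
  · exact ⟨(a, b, c), ⟨ha, hab, hbc, ht⟩, rfl, rfl, rfl, Or.inl ⟨rfl, by show b = min c b; rw [min_eq_right hbc], le_trans hab hbc, hab⟩⟩
  · exact ⟨(a, c, b), ⟨ha, hac, hbc, TALin1200.tableOK_swap23 ht⟩, by show a * c * b = a * b * c; ring,
      by show a * c + c * b + b * a = a * b + b * c + c * a; ring, by show a + c + b = a + b + c; ring,
      Or.inl ⟨rfl, by show c = min c b; rw [min_eq_left hbc], hac, hab⟩⟩
  · exact ⟨(c, a, b), ⟨hc, hac, hab, TALin1200.tableOK_swap23 (TALin1200.tableOK_swap13 ht)⟩, by show c * a * b = a * b * c; ring,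
      by show c * a + a * b + b * c = a * b + b * c + c * a; ring, by show c + a + b = a + b + c; ring,
      Or.inr (Or.inr ⟨rfl, by show a = min b a; rw [min_eq_right hab], le_trans hac hab, hac⟩)⟩
  · exact ⟨(b, a, c), ⟨hb, hab, hac, TALin1200.tableOK_swap12 ht⟩, by show b * a * c = a * b * c; ring,
      by show b * a + a * c + c * b = a * b + b * c + c * a; ring, by show b + a + c = a + b + c; ring,
      Or.inr (Or.inl ⟨rfl, by show a = min a c; rw [min_eq_left hac], hab, hbc⟩)⟩
  · exact ⟨(b, c, a), ⟨hb, hbc, hac, TALin1200.tableOK_swap23 (TALin1200.tableOK_swap12 ht)⟩, by show b * c * a = a * b * c; ring,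
      by show b * c + c * a + a * b = a * b + b * c + c * a; ring, by show b + c + a = a + b + c; ring,
      Or.inr (Or.inl ⟨rfl, by show c = min a c; rw [min_eq_right hac], hab, hbc⟩)⟩
  · exact ⟨(c, b, a), ⟨hc, hbc, hab, TALin1200.tableOK_swap13 ht⟩, by show c * b * a = a * b * c; ring,
      by show c * b + b * a + a * c = a * b + b * c + c * a; ring, by show c + b + a = a + b + c; ring,
      Or.inr (Or.inr ⟨rfl, by show b = min b a; rw [min_eq_left hab], hbc, le_trans hbc hab⟩)⟩
  · exact ⟨(c, b, a), ⟨hc, hbc, hab, TALin1200.tableOK_swap13 ht⟩, by show c * b * a = a * b * c; ring,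
      by show c * b + b * a + a * c = a * b + b * c + c * a; ring, by show c + b + a = a + b + c; ring,
      Or.inr (Or.inr ⟨rfl, by show b = min b a; rw [min_eq_left hab], hbc, hac⟩)⟩

/-! ## Unpacking the Boolean certificates -/

/-- `domV n V₀`: every listed shape of every volume of `[V₀, V₀+n)` is dominated. [bookkeeping] -/
theorem domV_sound : ∀ (n V₀ : ℕ), TAStatB.domV n V₀ = true → ∀ V, V₀ ≤ V → V < V₀ + n →
    ∀ x ∈ TAStatB.triplesS V, TAStatB.domX V (gainOf2371h V) x = true
  | 0, V₀, _, V, h1, h2, _, _ => by omega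
  | n + 1, V₀, h, V, h1, h2, x, hx => by
    have hunf : domV (n + 1) V₀ = ((triplesS V₀).all (domX V₀ (gainOf2371h V₀)) && domV n (V₀ + 1)) := rfl
    rw [hunf, Bool.and_eq_true] at h
    rcases Nat.eq_or_lt_of_le h1 with rfl | hlt
    · exact List.all_eq_true.1 h.1 x hx
    · exact domV_sound n (V₀ + 1) h.2 V hlt (by omega) x hx

/-- `checkV n V₀`: every listed shape of every volume of `[V₀, V₀+n)` passes `checkShape`. [bookkeeping] -/
theorem checkV_sound : ∀ (n V₀ : ℕ), TAStatB.checkV n V₀ = true → ∀ V, V₀ ≤ V → V < V₀ + n →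
    ∀ x ∈ TAStatB.triplesS V, TAStatB.checkShape V (gainOf2371h V) x = true
  | 0, V₀, _, V, h1, h2, _, _ => by omega
  | n + 1, V₀, h, V, h1, h2, x, hx => by
    have hunf : checkV (n + 1) V₀ = ((triplesS V₀).all (checkShape V₀ (gainOf2371h V₀)) && checkV n (V₀ + 1)) := rfl
    rw [hunf, Bool.and_eq_true] at h
    rcases Nat.eq_or_lt_of_le h1 with rfl | hlt
    · exact List.all_eq_true.1 h.1 x hx
    · exact checkV_sound n (V₀ + 1) h.2 V hlt (by omega) x hx

/-- `domWrow` along a dropped row: domination at every bucket `j′ ∈ [j, row.length)`. [bookkeeping] -/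
theorem domWrow_sound (g V p : ℕ) : ∀ (es : List Entry) (j : ℕ), TAStatB.domWrow g V p es j = true →
    ∀ k, k < es.length → V < TAStatB.tb (j + k) * p ∧ g * (es.getD k e0).2.2.2 ≤ (es.getD k e0).2.2.1 * (TAStatB.tb (j + k) * p - V)
  | [], j, _, k, hk => by simp at hk
  | e :: es, j, h, k, hk => by
    have hunf : domWrow g V p (e :: es) j =
        (Nat.blt V (tb j * p) && Nat.ble (g * e.2.2.2) (e.2.2.1 * (tb j * p - V)) && domWrow g V p es (j + 1)) := rfl
    rw [hunf, Bool.and_eq_true, Bool.and_eq_true, Nat.blt_eq, Nat.ble_eq] at h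
    obtain ⟨⟨h1, h2⟩, h3⟩ := h
    cases k with
    | zero => simpa using ⟨h1, h2⟩
    | succ k =>
      have hk' : k < es.length := by simpa using hk
      have := domWrow_sound g V p es (j + 1) h3 k hk'
      simpa [Nat.add_right_comm j 1 k, Nat.add_assoc] using this

/-- `walk` along a dropped row: `cover` holds at every bucket `j′ ∈ [j, row.length)` up to which the stop test has not fired. [bookkeeping] -/
theorem walk_sound (g p V d L H : ℕ) : ∀ (es : List Entry) (j : ℕ), TAStatB.walk g p V d L H es j = true →
    ∀ k, k < es.length → (∀ k', k' ≤ k → TAStatB.tb (j + k') * TAStatB.tb (j + k') * TAStatB.tb (j + k') ≤ V * V) →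
      cover g p V d (TAStatB.tb (j + k)) L H (es.getD k e0) = true
  | [], j, _, k, hk, _ => by simp at hk
  | e :: es, j, h, k, hk, hsmall => by
    have hunf : walk g p V d L H (e :: es) j =
        (Nat.blt (V * V) (tb j * tb j * tb j) || (cover g p V d (tb j) L H e && walk g p V d L H es (j + 1))) := rfl
    rw [hunf, Bool.or_eq_true, Nat.blt_eq, Bool.and_eq_true] at h
    rcases h with hstop | ⟨hc, hrest⟩
    · have := hsmall 0 (Nat.zero_le _)
      simp only [Nat.add_zero] at this
      omega
    · cases k with
      | zero => simpa using hc
      | succ k =>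
        have hk' : k < es.length := by simpa using hk
        have := walk_sound g p V d L H es (j + 1) hrest k hk' (fun k' hk'' => by
          have := hsmall (k' + 1) (by omega)
          simpa [Nat.add_right_comm j 1 k', Nat.add_assoc] using this)
        simpa [Nat.add_right_comm j 1 k, Nat.add_assoc] using this

/-! ## Domination, packaged -/

/-- vM fraction transfer along levels: `leP (ent i j) (ent i' j)` for `i ≤ i' < nl`, `j < nb`. [bookkeeping] -/
theorem mono_P_lev (hmono : TAStatB.monoOK TAStatBData.nl TAStatBData.nb = true) {i i' j : ℕ} (hii : i ≤ i') (hi' : i' < nl) (hj : j < nb) :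
    (TAStatB.ent i j).1 * (TAStatB.ent i' j).2.1 ≤ (TAStatB.ent i' j).1 * (TAStatB.ent i j).2.1 ∧ 1 ≤ (TAStatB.ent i' j).2.1 := by
  -- unpack monoOK
  have hrow : ∀ i < nl, ∀ j < nb, 1 ≤ (ent i j).2.1 ∧ 1 ≤ (ent i j).2.2.2 ∧
      (i + 1 < nl → leP (ent i j) (ent (i + 1) j) = true ∧ leW (ent i j) (ent (i + 1) j) = true) ∧
      (j + 1 < nb → leP (ent i j) (ent i (j + 1)) = true) := by
    intro i hi j hj
    simp only [monoOK, Bool.and_eq_true, List.all_eq_true, List.mem_range, Nat.beq_eq, Nat.ble_eq, Bool.or_eq_true] at hmono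
    obtain ⟨⟨-, h2⟩, -⟩ := hmono
    obtain ⟨-, h3⟩ := h2 i hi
    obtain ⟨⟨⟨hp, hw⟩, hi1⟩, hj1⟩ := h3 j hj
    refine ⟨hp, hw, fun hlt => ?_, fun hlt => ?_⟩
    · rcases hi1 with hge | hh
      · omega
      · exact hh
    · rcases hj1 with hge | hh
      · omega
      · exact hh
  induction i', hii using Nat.le_induction with
  | base => exact ⟨by rw [Nat.mul_comm], (hrow i hi' j hj).1⟩
  | succ n hn ih =>
    obtain ⟨h1, hp⟩ := ih (by omega)
    have hstep := ((hrow n (by omega) j hj).2.2.1 hi').1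
    simp only [leP, Nat.ble_eq] at hstep
    refine ⟨?_, (hrow (n + 1) hi' j hj).1⟩
    -- (ent i j).1 / (ent i j).2.1 ≤ (ent n j).1/(ent n j).2.1 ≤ (ent (n+1) j).1/(ent (n+1) j).2.1
    have key : (ent i j).1 * (ent (n + 1) j).2.1 * (ent n j).2.1 ≤ (ent (n + 1) j).1 * (ent i j).2.1 * (ent n j).2.1 := by
      calc (ent i j).1 * (ent (n + 1) j).2.1 * (ent n j).2.1 = (ent i j).1 * (ent n j).2.1 * (ent (n + 1) j).2.1 := by ring
        _ ≤ (ent n j).1 * (ent i j).2.1 * (ent (n + 1) j).2.1 := Nat.mul_le_mul_right _ h1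
        _ = (ent n j).1 * (ent (n + 1) j).2.1 * (ent i j).2.1 := by ring
        _ ≤ (ent (n + 1) j).1 * (ent n j).2.1 * (ent i j).2.1 := Nat.mul_le_mul_right _ hstep
        _ = (ent (n + 1) j).1 * (ent i j).2.1 * (ent n j).2.1 := by ring
    exact Nat.le_of_mul_le_mul_right key hp

/-- vM fraction transfer along buckets: `leP (ent i j) (ent i j')` for `j ≤ j' < nb`, `i < nl`. [bookkeeping] -/
theorem mono_P_bkt (hmono : TAStatB.monoOK TAStatBData.nl TAStatBData.nb = true) {i j j' : ℕ} (hjj : j ≤ j') (hj' : j' < nb) (hi : i < nl) :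
    (TAStatB.ent i j).1 * (TAStatB.ent i j').2.1 ≤ (TAStatB.ent i j').1 * (TAStatB.ent i j).2.1 ∧ 1 ≤ (TAStatB.ent i j').2.1 := by
  have hrow : ∀ j < nb, 1 ≤ (ent i j).2.1 ∧ (j + 1 < nb → leP (ent i j) (ent i (j + 1)) = true) := by
    intro j hj
    simp only [monoOK, Bool.and_eq_true, List.all_eq_true, List.mem_range, Nat.beq_eq, Nat.ble_eq, Bool.or_eq_true] at hmono
    obtain ⟨⟨-, h2⟩, -⟩ := hmono
    obtain ⟨-, h3⟩ := h2 i hi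
    obtain ⟨⟨⟨hp, -⟩, -⟩, hj1⟩ := h3 j hj
    refine ⟨hp, fun hlt => ?_⟩
    rcases hj1 with hge | hh
    · omega
    · exact hh
  induction j', hjj using Nat.le_induction with
  | base => exact ⟨by rw [Nat.mul_comm], (hrow j hj').1⟩
  | succ n hn ih =>
    obtain ⟨h1, hp⟩ := ih (by omega)
    have hstep := (hrow n (by omega)).2 hj'
    simp only [leP, Nat.ble_eq] at hstep
    refine ⟨?_, (hrow (n + 1) hj').1⟩
    have key : (ent i j).1 * (ent i (n + 1)).2.1 * (ent i n).2.1 ≤ (ent i (n + 1)).1 * (ent i j).2.1 * (ent i n).2.1 := by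
      calc (ent i j).1 * (ent i (n + 1)).2.1 * (ent i n).2.1 = (ent i j).1 * (ent i n).2.1 * (ent i (n + 1)).2.1 := by ring
        _ ≤ (ent i n).1 * (ent i j).2.1 * (ent i (n + 1)).2.1 := Nat.mul_le_mul_right _ h1
        _ = (ent i n).1 * (ent i (n + 1)).2.1 * (ent i j).2.1 := by ring
        _ ≤ (ent i (n + 1)).1 * (ent i n).2.1 * (ent i j).2.1 := Nat.mul_le_mul_right _ hstep
        _ = (ent i (n + 1)).1 * (ent i j).2.1 * (ent i n).2.1 := by ring
    exact Nat.le_of_mul_le_mul_right key hp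

/-- U11-G fraction transfer along levels: `leW (ent i j) (ent i' j)` for `i ≤ i' < nl`, `j < nb`. [bookkeeping] -/
theorem mono_W_lev (hmono : TAStatB.monoOK TAStatBData.nl TAStatBData.nb = true) {i i' j : ℕ} (hii : i ≤ i') (hi' : i' < nl) (hj : j < nb) :
    (TAStatB.ent i j).2.2.1 * (TAStatB.ent i' j).2.2.2 ≤ (TAStatB.ent i' j).2.2.1 * (TAStatB.ent i j).2.2.2 ∧ 1 ≤ (TAStatB.ent i' j).2.2.2 := by
  have hrow : ∀ i < nl, 1 ≤ (ent i j).2.2.2 ∧ (i + 1 < nl → leW (ent i j) (ent (i + 1) j) = true) := by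
    intro i hi
    simp only [monoOK, Bool.and_eq_true, List.all_eq_true, List.mem_range, Nat.beq_eq, Nat.ble_eq, Bool.or_eq_true] at hmono
    obtain ⟨⟨-, h2⟩, -⟩ := hmono
    obtain ⟨-, h3⟩ := h2 i hi
    obtain ⟨⟨⟨-, hw⟩, hi1⟩, -⟩ := h3 j hj
    refine ⟨hw, fun hlt => ?_⟩
    rcases hi1 with hge | hh
    · omega
    · exact hh.2
  induction i', hii using Nat.le_induction with
  | base => exact ⟨by rw [Nat.mul_comm], (hrow i hi').1⟩
  | succ n hn ih =>
    obtain ⟨h1, hp⟩ := ih (by omega)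
    have hstep := (hrow n (by omega)).2 hi'
    simp only [leW, Nat.ble_eq] at hstep
    refine ⟨?_, (hrow (n + 1) hi').1⟩
    have key : (ent i j).2.2.1 * (ent (n + 1) j).2.2.2 * (ent n j).2.2.2 ≤ (ent (n + 1) j).2.2.1 * (ent i j).2.2.2 * (ent n j).2.2.2 := by
      calc (ent i j).2.2.1 * (ent (n + 1) j).2.2.2 * (ent n j).2.2.2
          = (ent i j).2.2.1 * (ent n j).2.2.2 * (ent (n + 1) j).2.2.2 := by ring
        _ ≤ (ent n j).2.2.1 * (ent i j).2.2.2 * (ent (n + 1) j).2.2.2 := Nat.mul_le_mul_right _ h1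
        _ = (ent n j).2.2.1 * (ent (n + 1) j).2.2.2 * (ent i j).2.2.2 := by ring
        _ ≤ (ent (n + 1) j).2.2.1 * (ent n j).2.2.2 * (ent i j).2.2.2 := Nat.mul_le_mul_right _ hstep
        _ = (ent (n + 1) j).2.2.1 * (ent i j).2.2.2 * (ent n j).2.2.2 := by ring
    exact Nat.le_of_mul_le_mul_right key hp

/-- **Domination, packaged.**  With the table facts and the domination of every sorted candidate established (`monoOK`, `domV` on all volumes
`1 … Mtop`): a sorted candidate shape `x` of volume `≤ Vl ≤ Mtop` with `tm x ≤ t*` (`1 ≤ t* ≤ 317`) is dominated by the entry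
`e = ent (levOf Vl) (bucketOf t*)` read at `t′ = tb (bucketOf t*)`: `g(vol x)·pP ≤ gP·us x`, `vol x < t′·us x`, `g(vol x)·wW ≤ gW·(t′·us x − vol x)`,
with `pP, wW ≥ 1`. [original] -/
theorem dominated (hmono : TAStatB.monoOK TAStatBData.nl TAStatBData.nb = true)
    (hdom : ∀ V, 1 ≤ V → V ≤ 5666 → ∀ x ∈ TAStatB.triplesS V, TAStatB.domX V (gainOf2371h V) x = true)
    {x : ℕ × ℕ × ℕ} (hx : TAStatB.SCand x) {Vl ts : ℕ} (hVl : Vl ≤ 5666) (hxV : vol x ≤ Vl) (hts1 : 1 ≤ ts) (hts : ts ≤ 317)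
    (hxt : tm x ≤ ts) :
    let e := ent (levOf Vl) (bucketOf ts)
    1 ≤ e.2.1 ∧ 1 ≤ e.2.2.2 ∧ gainOf2371h (vol x) * e.2.1 ≤ e.1 * us x ∧ vol x < tb (bucketOf ts) * us x ∧
      gainOf2371h (vol x) * e.2.2.2 ≤ e.2.2.1 * (tb (bucketOf ts) * us x - vol x) := by
  intro e
  obtain ⟨a, b, c⟩ := x
  obtain ⟨ha, hab, hbc, ht⟩ := hx
  simp only at ha hab hbc ht
  have hvol : vol (a, b, c) = a * b * c := rfl
  have hV1 : 1 ≤ a * b * c := Nat.mul_pos (Nat.mul_pos ha (le_trans ha hab)) (le_trans (le_trans ha hab) hbc)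
  have hVx : a * b * c ≤ 5666 := by rw [← hvol]; exact hxV.trans hVl
  have hmem : (a, b, c) ∈ triplesS (a * b * c) := mem_triplesS ⟨ha, hab, hbc, ht⟩
  have hd := hdom (a * b * c) hV1 hVx _ hmem
  have htm : tm (a, b, c) = a * b := tm_sorted hab hbc
  -- indices
  set i₀ := levOf (a * b * c) with hi₀
  set j₀ := bucketOf (a * b) with hj₀
  set i := levOf Vl with hi
  set j := bucketOf ts with hj
  have hi₀i : i₀ ≤ i := levOf_mono (by rw [← hvol]; exact hxV) hVl
  have hinl : i < nl := (levOf_spec Vl hVl).1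
  have hi₀nl : i₀ < nl := (levOf_spec _ hVx).1
  have htm1 : 1 ≤ a * b := Nat.mul_pos ha (le_trans ha hab)
  have htmts : a * b ≤ ts := by rw [← htm]; exact hxt
  have hj₀j : j₀ ≤ j := bucketOf_mono htmts (by omega)
  have hjs := bucketOf_spec ts (by omega) hts1
  have hjnb : j < nb := hjs.1
  have hj₀s := bucketOf_spec (a * b) (by omega) htm1
  -- unpack domX
  simp only [domX, Bool.and_eq_true, htm] at hd
  obtain ⟨hP, hW⟩ := hd
  simp only [domP, Nat.ble_eq] at hP
  -- the row of level i₀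
  have hlen : (E.getD i₀ []).length = nb := row_length i₀ hi₀nl
  have hk : j - j₀ < ((E.getD i₀ []).drop j₀).length := by rw [List.length_drop, hlen]; omega
  have hW' := domWrow_sound _ _ _ _ _ hW (j - j₀) hk
  rw [getD_drop_add, show j₀ + (j - j₀) = j by omega] at hW'
  -- hP : g * (ent i₀ j₀).2.1 ≤ (ent i₀ j₀).1 * us ;  hW' : V < tb j * us ∧ g * (ent i₀ j).wW ≤ (ent i₀ j).gW * (tb j * us - V)
  change gainOf2371h (a * b * c) * (ent i₀ j₀).2.1 ≤ (ent i₀ j₀).1 * us (a, b, c) at hP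
  change a * b * c < tb j * us (a, b, c) ∧ gainOf2371h (a * b * c) * (ent i₀ j).2.2.2 ≤ (ent i₀ j).2.2.1 * (tb j * us (a, b, c) - a * b * c)
    at hW'
  obtain ⟨hlt, hWd⟩ := hW'
  -- transfer P: (i₀, j₀) → (i₀, j) → (i, j)
  obtain ⟨hPj, hp1⟩ := mono_P_bkt hmono hj₀j hjnb hi₀nl
  obtain ⟨hPi, hp2⟩ := mono_P_lev hmono hi₀i hinl hjnb
  obtain ⟨hWi, hw2⟩ := mono_W_lev hmono hi₀i hinl hjnb
  have hp0 : 1 ≤ (ent i₀ j₀).2.1 := (mono_P_bkt hmono le_rfl (by omega) hi₀nl).2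
  have hw0 : 1 ≤ (ent i₀ j).2.2.2 := (mono_W_lev hmono le_rfl hi₀nl hjnb).2
  set g := gainOf2371h (a * b * c)
  set u := us (a, b, c)
  have hP1 : g * (ent i₀ j).2.1 ≤ (ent i₀ j).1 * u := by
    have key : g * (ent i₀ j).2.1 * (ent i₀ j₀).2.1 ≤ (ent i₀ j).1 * u * (ent i₀ j₀).2.1 := by
      calc g * (ent i₀ j).2.1 * (ent i₀ j₀).2.1 = g * (ent i₀ j₀).2.1 * (ent i₀ j).2.1 := by ring
        _ ≤ (ent i₀ j₀).1 * u * (ent i₀ j).2.1 := Nat.mul_le_mul_right _ hP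
        _ = (ent i₀ j₀).1 * (ent i₀ j).2.1 * u := by ring
        _ ≤ (ent i₀ j).1 * (ent i₀ j₀).2.1 * u := Nat.mul_le_mul_right _ hPj
        _ = (ent i₀ j).1 * u * (ent i₀ j₀).2.1 := by ring
    exact Nat.le_of_mul_le_mul_right key hp0
  have hP2 : g * (ent i j).2.1 ≤ (ent i j).1 * u := by
    have key : g * (ent i j).2.1 * (ent i₀ j).2.1 ≤ (ent i j).1 * u * (ent i₀ j).2.1 := by
      calc g * (ent i j).2.1 * (ent i₀ j).2.1 = g * (ent i₀ j).2.1 * (ent i j).2.1 := by ring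
        _ ≤ (ent i₀ j).1 * u * (ent i j).2.1 := Nat.mul_le_mul_right _ hP1
        _ = (ent i₀ j).1 * (ent i j).2.1 * u := by ring
        _ ≤ (ent i j).1 * (ent i₀ j).2.1 * u := Nat.mul_le_mul_right _ hPi
        _ = (ent i j).1 * u * (ent i₀ j).2.1 := by ring
    exact Nat.le_of_mul_le_mul_right key hp1
  have hW2 : g * (ent i j).2.2.2 ≤ (ent i j).2.2.1 * (tb j * u - a * b * c) := by
    have key : g * (ent i j).2.2.2 * (ent i₀ j).2.2.2 ≤ (ent i j).2.2.1 * (tb j * u - a * b * c) * (ent i₀ j).2.2.2 := by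
      calc g * (ent i j).2.2.2 * (ent i₀ j).2.2.2 = g * (ent i₀ j).2.2.2 * (ent i j).2.2.2 := by ring
        _ ≤ (ent i₀ j).2.2.1 * (tb j * u - a * b * c) * (ent i j).2.2.2 := Nat.mul_le_mul_right _ hWd
        _ = (ent i₀ j).2.2.1 * (ent i j).2.2.2 * (tb j * u - a * b * c) := by ring
        _ ≤ (ent i j).2.2.1 * (ent i₀ j).2.2.2 * (tb j * u - a * b * c) := Nat.mul_le_mul_right _ hWi
        _ = (ent i j).2.2.1 * (tb j * u - a * b * c) * (ent i₀ j).2.2.2 := by ring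
    exact Nat.le_of_mul_le_mul_right key hw0
  exact ⟨hp2, hw2, hP2, hlt, hW2⟩

end Summit.MatrixMultiplication.MatrixMultiplication.Theorems.TAStatB
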